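import Mathlib.Analysis.InnerProductSpace.Projection.FiniteDimensional
import Mathlib.Analysis.InnerProductSpace.Projection.Reflection
import Mathlib.Analysis.SpecialFunctions.Complex.Arg
import Literature.Probability.LatticeModels.ConformalCovariance
import HarnessLib

/-!
# Route GaussianScaleMixture — crux `RotationUpgradeFromTwoPoint` (stmt-CriticalPhenomena-8367),
# line `two-crystals-generate-so3`, stub `stub_rotationsFromTwoCircles`

THEOREM-ONLY file (no definitions, no notation). **Two circle groups about orthogonal axes and one
coordinate reflection generate `O(3)`.** Let `S : CorrFamily 3` and let
`Γ := {T : ℝ³ ≃ₗᵢ ℝ³ | ∀ n x, S n (T ∘ x) = S n x}` be its invariance group (a subgroup of the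
orthogonal group). Suppose that, for some frame `W`, `Γ` contains for every angle `φ` an element
acting in `W`-coordinates as the rotation `R_z(φ)` about the third axis, one acting as the
rotation `R_x(φ)` about the first axis, and the coordinate reflection `x ↦ (-x₀, x₁, x₂)`. Then
`S` is `IsRotationInvariant`, i.e. `Γ` is everything.

Proof (pure group theory, no continuity).
* For every vector `v` some `γ ∈ Γ` maps `v` to a multiple of `W e₀` (`e₀` the first standard
  basis vector): in `W`-coordinates first rotate about the first axis to kill the third
  coordinate, then about the third axis to kill the second one (`rtc_align`; the angles exist by
  the polar form of a complex number, `rtc_angle`).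
* The coordinate reflection is the reflection in the plane `(ℝ ∙ e₀)ᗮ` (`rtc_reflection_axis_apply`),
  so `(ℝ ∙ e₀)ᗮ.reflection ∈ Γ`.
* Conjugation: `(ℝ ∙ γ v)ᗮ.reflection = γ * (ℝ ∙ v)ᗮ.reflection * γ⁻¹` (`Submodule.reflection_map`,
  `rtc_reflection_conj`), and rescaling `v` does not change the reflection. Hence the set of `v`
  with `(ℝ ∙ v)ᗮ.reflection ∈ Γ` contains `e₀`, then `W e₀`, then every nonzero `v`, and `v = 0`
  trivially (the reflection in `(ℝ ∙ 0)ᗮ = ⊤` is the identity).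
* Cartan–Dieudonné (`LinearIsometryEquiv.reflections_generate`): the reflections generate the
  orthogonal group, so `Γ = ⊤`.
-/

noncomputable section

open Literature.Probability.LatticeModels

namespace Summit.CriticalPhenomena.Ising3DConformalLimit.Cruxes.RotationUpgradeFromTwoPoint.TwoCrystalsGenerateSo3

/-- Reflections in equal subspaces agree (the `HasOrthogonalProjection` instance is a `Prop`, so
no transport is needed). [folklore] -/
theorem rtc_reflection_congr {K L : Submodule ℝ (EuclideanSpace ℝ (Fin 3))}
    [K.HasOrthogonalProjection] [L.HasOrthogonalProjection] (h : K = L) :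
    K.reflection = L.reflection := by
  subst h
  rfl

/-- Conjugating the reflection in the hyperplane `(ℝ ∙ v)ᗮ` by a linear isometry `γ` gives the
reflection in the hyperplane `(ℝ ∙ γ v)ᗮ` (`Submodule.reflection_map` plus
`Submodule.map_orthogonal_equiv`). [folklore] -/
theorem rtc_reflection_conj
    (γ : EuclideanSpace ℝ (Fin 3) ≃ₗᵢ[ℝ] EuclideanSpace ℝ (Fin 3)) (v : EuclideanSpace ℝ (Fin 3)) :
    (ℝ ∙ γ v)ᗮ.reflection = γ * (ℝ ∙ v)ᗮ.reflection * γ⁻¹ := by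
  have hK : ((ℝ ∙ v)ᗮ).map
      (γ.toLinearEquiv : EuclideanSpace ℝ (Fin 3) →ₗ[ℝ] EuclideanSpace ℝ (Fin 3)) = (ℝ ∙ γ v)ᗮ := by
    rw [Submodule.map_orthogonal_equiv, Submodule.map_span, Set.image_singleton]
    rfl
  rw [← rtc_reflection_congr hK, Submodule.reflection_map]
  rfl

/-- Rescaling `v` by a nonzero scalar does not change the reflection in `(ℝ ∙ v)ᗮ`. [folklore] -/
theorem rtc_reflection_smul {c : ℝ} (hc : c ≠ 0) (v : EuclideanSpace ℝ (Fin 3)) :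
    (ℝ ∙ (c • v))ᗮ.reflection = (ℝ ∙ v)ᗮ.reflection :=
  rtc_reflection_congr (by rw [Submodule.span_singleton_smul_eq hc.isUnit])

/-- The reflection in `(ℝ ∙ 0)ᗮ = ⊤` is the identity. [folklore] -/
theorem rtc_reflection_zero :
    (ℝ ∙ (0 : EuclideanSpace ℝ (Fin 3)))ᗮ.reflection = 1 := by
  refine LinearIsometryEquiv.ext fun x => ?_
  rw [LinearIsometryEquiv.coe_one, id_eq]
  apply Submodule.reflection_mem_subspace_eq_self
  rw [Submodule.mem_orthogonal_singleton_iff_inner_right, inner_zero_left]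

/-- The reflection in the plane orthogonal to the first coordinate axis flips the sign of the
first coordinate: `(ℝ ∙ e₀)ᗮ.reflection x = (-x₀, x₁, x₂)`. [folklore] -/
theorem rtc_reflection_axis_apply (x : EuclideanSpace ℝ (Fin 3)) :
    (ℝ ∙ EuclideanSpace.single (0 : Fin 3) (1 : ℝ))ᗮ.reflection x =
      WithLp.toLp 2 ![-x 0, x 1, x 2] := by
  rw [Submodule.reflection_orthogonal_apply, Submodule.reflection_singleton_apply]
  ext j
  fin_cases j
  · simp [EuclideanSpace.inner_single_left]
    ring
  · simp [EuclideanSpace.inner_single_left]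
  · simp [EuclideanSpace.inner_single_left]

/-- For all reals `a, b` there is an angle `φ` with `sin φ · a + cos φ · b = 0` (take
`φ := -arg (a + b i)`, polar form of a complex number). [folklore] -/
theorem rtc_angle (a b : ℝ) : ∃ φ : ℝ, Real.sin φ * a + Real.cos φ * b = 0 := by
  refine ⟨-Complex.arg ⟨a, b⟩, ?_⟩
  have hc : ‖(⟨a, b⟩ : ℂ)‖ * Real.cos (Complex.arg ⟨a, b⟩) = a := Complex.norm_mul_cos_arg ⟨a, b⟩
  have hs : ‖(⟨a, b⟩ : ℂ)‖ * Real.sin (Complex.arg ⟨a, b⟩) = b := Complex.norm_mul_sin_arg ⟨a, b⟩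
  rw [Real.sin_neg, Real.cos_neg]
  linear_combination Real.sin (Complex.arg ⟨a, b⟩) * hc - Real.cos (Complex.arg ⟨a, b⟩) * hs

/-- Two coordinate rotations align any vector with the first axis: for every `u : ℝ³` there are
angles `φ₁, φ₂` with `R_z(φ₂) (R_x(φ₁) u) = r • e₀` for some real `r` (first kill the third
coordinate, then the second). [folklore] -/
theorem rtc_align (Rz Rx : ℝ → EuclideanSpace ℝ (Fin 3) → EuclideanSpace ℝ (Fin 3))
    (hRz : ∀ φ x, Rz φ x = WithLp.toLp 2
      ![Real.cos φ * x 0 - Real.sin φ * x 1, Real.sin φ * x 0 + Real.cos φ * x 1, x 2])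
    (hRx : ∀ φ x, Rx φ x = WithLp.toLp 2
      ![x 0, Real.cos φ * x 1 - Real.sin φ * x 2, Real.sin φ * x 1 + Real.cos φ * x 2])
    (u : EuclideanSpace ℝ (Fin 3)) :
    ∃ φ₁ φ₂ r : ℝ, Rz φ₂ (Rx φ₁ u) = r • EuclideanSpace.single (0 : Fin 3) (1 : ℝ) := by
  obtain ⟨φ₁, h₁⟩ := rtc_angle (u 1) (u 2)
  obtain ⟨φ₂, h₂⟩ := rtc_angle (u 0) (Real.cos φ₁ * u 1 - Real.sin φ₁ * u 2)
  refine ⟨φ₁, φ₂, Real.cos φ₂ * u 0 - Real.sin φ₂ * (Real.cos φ₁ * u 1 - Real.sin φ₁ * u 2), ?_⟩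
  rw [hRx, hRz]
  ext j
  fin_cases j
  · simp
  · simp
    linear_combination h₂
  · simp
    linear_combination h₁

/-- **Stub `stub_rotationsFromTwoCircles`.** Two conjugate coordinate circles and one coordinate
reflection give `O(3)`: if the invariance group of a family `S` on `ℝ³` contains, for some linear
isometry `W` (a frame), for every `φ` an element acting as `W R_z(φ) W⁻¹` and one acting as
`W R_x(φ) W⁻¹`, and the coordinate reflection `x ↦ (−x₀, x₁, x₂)`, then `S` is
`IsRotationInvariant`. Proof: the invariance group `Γ` moves every vector to a multiple of `W e₀`
(`rtc_align`), contains the reflection `(ℝ ∙ e₀)ᗮ.reflection` (`rtc_reflection_axis_apply`), hence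
by conjugation (`rtc_reflection_conj`) and rescaling (`rtc_reflection_smul`) every hyperplane
reflection, hence everything by Cartan–Dieudonné (`LinearIsometryEquiv.reflections_generate`). [folklore] -/
theorem stub_rotationsFromTwoCircles :
  ∀ (Rz Rx : ℝ → EuclideanSpace ℝ (Fin 3) → EuclideanSpace ℝ (Fin 3)),
    (∀ φ x, Rz φ x = WithLp.toLp 2
      ![Real.cos φ * x 0 - Real.sin φ * x 1, Real.sin φ * x 0 + Real.cos φ * x 1, x 2]) →
    (∀ φ x, Rx φ x = WithLp.toLp 2
      ![x 0, Real.cos φ * x 1 - Real.sin φ * x 2, Real.sin φ * x 1 + Real.cos φ * x 2]) →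
    ∀ (S : CorrFamily 3) (W : EuclideanSpace ℝ (Fin 3) ≃ₗᵢ[ℝ] EuclideanSpace ℝ (Fin 3)),
    (∀ φ : ℝ, ∃ T : EuclideanSpace ℝ (Fin 3) ≃ₗᵢ[ℝ] EuclideanSpace ℝ (Fin 3), (∀ x, T (W x) = W (Rz φ x)) ∧
      ∀ (n : ℕ) (x : Fin n → EuclideanSpace ℝ (Fin 3)), S n (fun i => T (x i)) = S n x) →
    (∀ φ : ℝ, ∃ T : EuclideanSpace ℝ (Fin 3) ≃ₗᵢ[ℝ] EuclideanSpace ℝ (Fin 3), (∀ x, T (W x) = W (Rx φ x)) ∧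
      ∀ (n : ℕ) (x : Fin n → EuclideanSpace ℝ (Fin 3)), S n (fun i => T (x i)) = S n x) →
    (∃ F : EuclideanSpace ℝ (Fin 3) ≃ₗᵢ[ℝ] EuclideanSpace ℝ (Fin 3), (∀ x, F x = WithLp.toLp 2 ![-x 0, x 1, x 2]) ∧
      ∀ (n : ℕ) (x : Fin n → EuclideanSpace ℝ (Fin 3)), S n (fun i => F (x i)) = S n x) →
    IsRotationInvariant S := by
  intro Rz Rx hRz hRx S W hZ hX hF
  -- (0) the invariance group of `S`
  let Γ : Subgroup (EuclideanSpace ℝ (Fin 3) ≃ₗᵢ[ℝ] EuclideanSpace ℝ (Fin 3)) :=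
    { carrier := {T | ∀ (n : ℕ) (x : Fin n → EuclideanSpace ℝ (Fin 3)),
        S n (fun i => T (x i)) = S n x}
      mul_mem' := by
        intro a b ha hb n x
        have hab : (fun i => (a * b) (x i)) = fun i => a (b (x i)) := rfl
        rw [hab, ha n (fun i => b (x i)), hb n x]
      one_mem' := by
        intro n x
        rfl
      inv_mem' := by
        intro a ha n x
        have h := ha n (fun i => a⁻¹ (x i))
        have hx : (fun i => a (a⁻¹ (x i))) = x := funext fun i => a.apply_symm_apply (x i)
        rw [hx] at h
        exact h.symm }
  -- (1) every vector is moved onto the axis `ℝ ∙ W e₀` by an element of `Γ`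
  have hmove : ∀ v : EuclideanSpace ℝ (Fin 3), ∃ T ∈ Γ, ∃ r : ℝ,
      T v = r • W (EuclideanSpace.single 0 1) := by
    intro v
    obtain ⟨φ₁, φ₂, r, h⟩ := rtc_align Rz Rx hRz hRx (W.symm v)
    obtain ⟨T₁, hT₁W, hT₁⟩ := hX φ₁
    obtain ⟨T₂, hT₂W, hT₂⟩ := hZ φ₂
    refine ⟨T₂ * T₁, Γ.mul_mem hT₂ hT₁, r, ?_⟩
    calc (T₂ * T₁) v = T₂ (T₁ (W (W.symm v))) := by
          rw [LinearIsometryEquiv.coe_mul, Function.comp_apply, W.apply_symm_apply]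
      _ = W (Rz φ₂ (Rx φ₁ (W.symm v))) := by rw [hT₁W, hT₂W]
      _ = r • W (EuclideanSpace.single 0 1) := by rw [h, LinearIsometryEquiv.map_smul]
  -- (2) the coordinate reflection is the reflection in `(ℝ ∙ e₀)ᗮ`
  have hP0 : (ℝ ∙ EuclideanSpace.single (0 : Fin 3) (1 : ℝ))ᗮ.reflection ∈ Γ := by
    obtain ⟨F, hFx, hFS⟩ := hF
    intro n x
    have hx : (fun i => (ℝ ∙ EuclideanSpace.single (0 : Fin 3) (1 : ℝ))ᗮ.reflection (x i)) =
        fun i => F (x i) := funext fun i => by rw [rtc_reflection_axis_apply, hFx]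
    rw [hx]
    exact hFS n x
  -- (3) conjugation moves hyperplane reflections around
  have hPconj : ∀ γ ∈ Γ, ∀ v : EuclideanSpace ℝ (Fin 3),
      (ℝ ∙ v)ᗮ.reflection ∈ Γ → (ℝ ∙ γ v)ᗮ.reflection ∈ Γ := by
    intro γ hγ v hv
    rw [rtc_reflection_conj]
    exact Γ.mul_mem (Γ.mul_mem hγ hv) (Γ.inv_mem hγ)
  -- (4) the reflection in `(ℝ ∙ W e₀)ᗮ` lies in `Γ`
  have hPW : (ℝ ∙ W (EuclideanSpace.single (0 : Fin 3) (1 : ℝ)))ᗮ.reflection ∈ Γ := by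
    obtain ⟨T, hT, r, hr⟩ := hmove (EuclideanSpace.single 0 1)
    have hr0 : r ≠ 0 := by
      rintro rfl
      rw [zero_smul] at hr
      have h0 : EuclideanSpace.single (0 : Fin 3) (1 : ℝ) = 0 :=
        T.injective (by rw [hr, map_zero])
      exact one_ne_zero ((PiLp.single_eq_zero_iff 2 (0 : Fin 3)).mp h0)
    have h1 := hPconj T hT _ hP0
    rwa [hr, rtc_reflection_smul hr0] at h1
  -- (5) every hyperplane reflection lies in `Γ`
  have hall : ∀ v : EuclideanSpace ℝ (Fin 3), (ℝ ∙ v)ᗮ.reflection ∈ Γ := by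
    intro v
    by_cases hv : v = 0
    · rw [hv, rtc_reflection_zero]
      exact Γ.one_mem
    obtain ⟨T, hT, r, hr⟩ := hmove v
    have hr0 : r ≠ 0 := by
      rintro rfl
      rw [zero_smul] at hr
      exact hv (T.injective (by rw [hr, map_zero]))
    have h1 : (ℝ ∙ T v)ᗮ.reflection ∈ Γ := by
      rw [hr, rtc_reflection_smul hr0]
      exact hPW
    have h2 := hPconj T⁻¹ (Γ.inv_mem hT) (T v) h1
    rwa [LinearIsometryEquiv.coe_inv, T.symm_apply_apply] at h2
  -- (6) Cartan–Dieudonné: reflections generate the orthogonal group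
  have htop : (⊤ : Subgroup (EuclideanSpace ℝ (Fin 3) ≃ₗᵢ[ℝ] EuclideanSpace ℝ (Fin 3))) ≤ Γ := by
    rw [← LinearIsometryEquiv.reflections_generate, Subgroup.closure_le]
    rintro _ ⟨v, rfl⟩
    exact hall v
  intro n R x
  have hR : R ∈ Γ := htop (Subgroup.mem_top R)
  exact hR n x

end Summit.CriticalPhenomena.Ising3DConformalLimit.Cruxes.RotationUpgradeFromTwoPoint.TwoCrystalsGenerateSo3

end
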